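import Summits.PneNP.PneNP.Theorems.SzkEntropyPeaThreeNotInPCoreDefs
import Mathlib.LinearAlgebra.Matrix.ToLin
import Mathlib.LinearAlgebra.Matrix.NonsingularInverse
import Mathlib.LinearAlgebra.Basis.VectorSpace
import Mathlib.LinearAlgebra.FiniteDimensional.Lemmas
import Mathlib.LinearAlgebra.Projection

/-!
# Route SzkEntropy, crux `PeaThreeNotInP` (stmt-PneNP-10776), line `SketchIdeator3`, step S7:
# full-column-rank matrices over `F₂` (registered stub `stub_linalg`)

Step S7 (full 3-Tensor Isomorphism `≤ₚ TensorIso` via concise cores) needs the uniqueness of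
concise cores up to isomorphism, which rests on three folklore facts about an `a × r` matrix `P`
over `F₂` of FULL COLUMN RANK (`P.rank = r`; equivalently the columns are linearly independent,
i.e. `P.mulVecLin` is injective — `linalg_ker_mulVecLin`):

* (iii) LEFT INVERSES (`linalg_leftInverse`): `∃ P', P' * P = 1` — a left inverse of the injective
  linear map `P.mulVecLin` (`LinearMap.exists_leftInverse_of_injective`) read back as a matrix.
* (ii) RANGE FACTOR (`linalg_rangeFactor`): if `P₁, P₂` have the same column space then
  `P₁ * g = P₂` for an invertible `r × r` matrix `g`, namely `g = P₁' * P₂` (`P₁ * P₁'` is the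
  identity on the column space of `P₁`, `linalg_mul_leftInv_mul`), with right inverse `P₂' * P₁`.
* (i) FRAME TRANSPORT (`linalg_frameTransport`): `A * P₁ = P₂` for an invertible `a × a` matrix
  `A` — the matrix of a linear automorphism `e` of `F₂^a` with `e ∘ P₁ = P₂`
  (`linalg_exists_equiv_comp`: match `range P₁ ≃ F₂^r ≃ range P₂` and complements of the two
  column spaces, which have equal dimension `a - r`).

No Gram matrix `Pᵀ P` is used (it may be singular in characteristic `2`, e.g. `P = (1,1)ᵀ`).
Sources: folklore linear algebra; used implicitly in J. A. Grochow, Y. Qiao, *On the complexity of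
isomorphism problems for tensors, groups, and polynomials I*, SIAM J. Comput. 52 (2023), §2.
-/

noncomputable section

open Matrix
open scoped Kronecker
open _root_.Computability
open Literature.Computability.Complexity

namespace Summit.PneNP.PneNP.Cruxes.PeaThreeNotInP.TensorIsoLine

set_option linter.dupNamespace false -- `Summit.PneNP.PneNP.…`: summit = sub-problem name (D-0017 single-conjunct layout)

/-! ### Injective linear maps into a finite-dimensional space differ by an automorphism -/

/-- Two injective linear maps `f₁, f₂ : V → W` into a finite-dimensional vector space `W` differ by
a linear automorphism `e` of `W`: `e ∘ f₁ = f₂` (decompose `W = range fᵢ ⊕ qᵢ` with complements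
`q₁, q₂` of equal dimension and match `range f₁ ≃ V ≃ range f₂`, `q₁ ≃ q₂`). [folklore] -/
theorem linalg_exists_equiv_comp {K V W : Type*} [Field K] [AddCommGroup V] [Module K V]
    [AddCommGroup W] [Module K W] [FiniteDimensional K W] (f₁ f₂ : V →ₗ[K] W)
    (h₁ : Function.Injective f₁) (h₂ : Function.Injective f₂) :
    ∃ e : W ≃ₗ[K] W, (e : W →ₗ[K] W) ∘ₗ f₁ = f₂ := by
  obtain ⟨p, hp⟩ := (LinearMap.range f₁).exists_isCompl
  obtain ⟨q, hq⟩ := (LinearMap.range f₂).exists_isCompl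
  have hpq : Module.finrank K p = Module.finrank K q := by
    have H₁ := Submodule.finrank_add_eq_of_isCompl hp
    have H₂ := Submodule.finrank_add_eq_of_isCompl hq
    rw [← (LinearEquiv.ofInjective f₁ h₁).finrank_eq] at H₁
    rw [← (LinearEquiv.ofInjective f₂ h₂).finrank_eq] at H₂
    omega
  refine ⟨(Submodule.prodEquivOfIsCompl _ p hp).symm ≪≫ₗ
      ((LinearEquiv.ofInjective f₁ h₁).symm ≪≫ₗ LinearEquiv.ofInjective f₂ h₂).prodCongr
        (LinearEquiv.ofFinrankEq p q hpq) ≪≫ₗ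
      Submodule.prodEquivOfIsCompl _ q hq, LinearMap.ext fun x => ?_⟩
  rw [LinearMap.comp_apply, LinearEquiv.coe_coe, LinearEquiv.trans_apply, LinearEquiv.trans_apply,
    show f₁ x = ↑(LinearEquiv.ofInjective f₁ h₁ x) from rfl,
    Submodule.prodEquivOfIsCompl_symm_apply_left]
  simp only [LinearEquiv.prodCongr_apply, LinearEquiv.trans_apply, LinearEquiv.symm_apply_apply,
    map_zero, Submodule.coe_prodEquivOfIsCompl', Submodule.coe_zero, add_zero,
    LinearEquiv.ofInjective_apply]

/-! ### Full column rank: injectivity and left inverses -/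

/-- Full column rank means that `P.mulVecLin` is injective (the `r` columns are linearly
independent as they span a space of dimension `r`). [folklore] -/
theorem linalg_ker_mulVecLin {a r : ℕ} {P : Matrix (Fin a) (Fin r) (ZMod 2)} (h : P.rank = r) :
    LinearMap.ker P.mulVecLin = ⊥ := by
  rw [LinearMap.ker_eq_bot, Matrix.coe_mulVecLin, Matrix.mulVec_injective_iff,
    linearIndependent_iff_card_eq_finrank_span, Set.finrank, ← Matrix.rank_eq_finrank_span_cols, h,
    Fintype.card_fin]

/-- **(iii) Left inverses.** An `a × r` matrix over `F₂` of full column rank has a left inverse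
`P' * P = 1` (a linear left inverse of the injective map `P.mulVecLin`, as a matrix). [folklore] -/
theorem linalg_leftInverse {a r : ℕ} (P : Matrix (Fin a) (Fin r) (ZMod 2)) (h : P.rank = r) :
    ∃ P' : Matrix (Fin r) (Fin a) (ZMod 2), P' * P = 1 := by
  obtain ⟨g, hg⟩ := LinearMap.exists_leftInverse_of_injective P.mulVecLin (linalg_ker_mulVecLin h)
  refine ⟨LinearMap.toMatrix' g, ?_⟩
  rw [← LinearMap.toMatrix'_toLin' P, ← LinearMap.toMatrix'_comp, Matrix.toLin'_apply', hg,
    LinearMap.toMatrix'_id]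

/-! ### Equal column spaces: an invertible right factor -/

/-- If `P₁' * P₁ = 1` then `P₁ * P₁'` is the identity on the column space of `P₁`
(`P₁ P₁' (P₁ z) = P₁ z`); hence `P₁ * (P₁' * P₂) = P₂` as soon as the column space of `P₂` is
contained in that of `P₁`. [folklore] -/
theorem linalg_mul_leftInv_mul {a r s : ℕ} {P₁ : Matrix (Fin a) (Fin r) (ZMod 2)}
    {P₁' : Matrix (Fin r) (Fin a) (ZMod 2)} (h₁ : P₁' * P₁ = 1)
    {P₂ : Matrix (Fin a) (Fin s) (ZMod 2)}
    (h : LinearMap.range P₂.mulVecLin ≤ LinearMap.range P₁.mulVecLin) :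
    P₁ * (P₁' * P₂) = P₂ := by
  refine Matrix.ext_iff_mulVec.mpr fun x => ?_
  obtain ⟨z, hz⟩ := LinearMap.mem_range.mp (h (LinearMap.mem_range_self P₂.mulVecLin x))
  rw [Matrix.mulVecLin_apply, Matrix.mulVecLin_apply] at hz
  rw [← Matrix.mulVec_mulVec, ← Matrix.mulVec_mulVec, ← hz, Matrix.mulVec_mulVec z P₁' P₁, h₁,
    Matrix.one_mulVec]

/-- **(ii) Range factor.** Two `a × r` matrices over `F₂` of full column rank with the same column
space differ by an invertible right factor: `P₁ * g = P₂` with `g = P₁' * P₂` invertible (right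
inverse `P₂' * P₁`, where `Pᵢ'` are left inverses). [folklore] -/
theorem linalg_rangeFactor {a r : ℕ} (P₁ P₂ : Matrix (Fin a) (Fin r) (ZMod 2)) (h₁ : P₁.rank = r)
    (h₂ : P₂.rank = r) (h : LinearMap.range P₁.mulVecLin = LinearMap.range P₂.mulVecLin) :
    ∃ g : Matrix (Fin r) (Fin r) (ZMod 2), IsUnit g ∧ P₁ * g = P₂ := by
  obtain ⟨P₁', h₁'⟩ := linalg_leftInverse P₁ h₁
  obtain ⟨P₂', h₂'⟩ := linalg_leftInverse P₂ h₂
  refine ⟨P₁' * P₂, IsUnit.of_mul_eq_one (P₂' * P₁) ?_, linalg_mul_leftInv_mul h₁' h.ge⟩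
  rw [Matrix.mul_assoc, linalg_mul_leftInv_mul h₂' h.le, h₁']

/-! ### Frame transport: an invertible left factor -/

/-- **(i) Frame transport.** Two `a × r` matrices over `F₂` of full column rank differ by an
invertible left factor: `A * P₁ = P₂` with `A` the matrix of a linear automorphism `e` of `F₂^a`
such that `e ∘ P₁ = P₂` (`linalg_exists_equiv_comp`). [folklore] -/
theorem linalg_frameTransport {a r : ℕ} (P₁ P₂ : Matrix (Fin a) (Fin r) (ZMod 2))
    (h₁ : P₁.rank = r) (h₂ : P₂.rank = r) :
    ∃ A : Matrix (Fin a) (Fin a) (ZMod 2), IsUnit A ∧ A * P₁ = P₂ := by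
  obtain ⟨e, he⟩ := linalg_exists_equiv_comp P₁.mulVecLin P₂.mulVecLin
    (LinearMap.ker_eq_bot.mp (linalg_ker_mulVecLin h₁))
    (LinearMap.ker_eq_bot.mp (linalg_ker_mulVecLin h₂))
  refine ⟨LinearMap.toMatrix' (e : _ →ₗ[ZMod 2] _),
    IsUnit.of_mul_eq_one (LinearMap.toMatrix' (e.symm : _ →ₗ[ZMod 2] _)) ?_, ?_⟩
  · rw [← LinearMap.toMatrix'_comp, LinearEquiv.comp_symm, LinearMap.toMatrix'_id]
  · rw [← LinearMap.toMatrix'_toLin' P₁, ← LinearMap.toMatrix'_comp, Matrix.toLin'_apply', he]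
    exact LinearMap.toMatrix'_toLin' P₂

/-! ### The registered stub -/

/-- **stub (W3)**: three folklore facts on `a × r` matrices of full column rank over `F₂` — frame
transport (they differ by an invertible left factor), equal column spaces give an invertible right
factor, and left inverses exist. [folklore] -/
theorem stub_linalg :
    (∀ {a r : ℕ} (P₁ P₂ : Matrix (Fin a) (Fin r) (ZMod 2)), P₁.rank = r → P₂.rank = r →
      ∃ A : Matrix (Fin a) (Fin a) (ZMod 2), IsUnit A ∧ A * P₁ = P₂) ∧
    (∀ {a r : ℕ} (P₁ P₂ : Matrix (Fin a) (Fin r) (ZMod 2)), P₁.rank = r → P₂.rank = r →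
      LinearMap.range P₁.mulVecLin = LinearMap.range P₂.mulVecLin →
      ∃ g : Matrix (Fin r) (Fin r) (ZMod 2), IsUnit g ∧ P₁ * g = P₂) ∧
    (∀ {a r : ℕ} (P : Matrix (Fin a) (Fin r) (ZMod 2)), P.rank = r →
      ∃ P' : Matrix (Fin r) (Fin a) (ZMod 2), P' * P = 1) := by
  exact ⟨fun P₁ P₂ h₁ h₂ => linalg_frameTransport P₁ P₂ h₁ h₂,
    fun P₁ P₂ h₁ h₂ h => linalg_rangeFactor P₁ P₂ h₁ h₂ h, fun P h => linalg_leftInverse P h⟩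

end Summit.PneNP.PneNP.Cruxes.PeaThreeNotInP.TensorIsoLine

end
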